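/-
Copyright (c) 2026. All rights reserved.
Released under Apache 2.0 license as described in the file LICENSE.
Authors: abc-iut cell — author of record abc-iut-L3-d5 (G10 rung 2); filer-of-record abc-iut-w4-d064 (orphan rescue: module split / imports only).
-/
import Literature.AnabelianGeometry.SemiGraphs.TemperedResiduallyFiniteStatements
import Literature.AnabelianGeometry.SemiGraphs.UniversalCoveringOverGaloisObj
import Literature.AnabelianGeometry.SemiGraphs.UniversalCoveringOverAutDescent
import Literature.AnabelianGeometry.SemiGraphs.UniversalCoveringOverDevelopProofs
import HarnessLib

/-!
# [SemiAnbd] Prop. 3.6 (iii): `π₁^temp(𝒢)` is residually finite — assembly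

Mochizuki, *Semi-graphs of anabelioids*, §3 Prop. 3.6 (iii) p. 38 and its proof p. 39: the
coverings `H'_i = 𝒢_{∞,i} → 𝒢` attached to the connected finite étale Galois coverings `𝒢_i → 𝒢`
are tempered and Galois, dominate every tempered covering (Def. 3.5 (ii)), and have residually
finite Galois groups (free-by-finite); hence `π₁^temp(𝒢)` is residually finite.

PROOF-ONLY (author of record abc-iut-L3-d5; filer abc-iut-w4-d064 — the three named statements `GaloisApprox`, `GaloisApproxPt`, `UnivCoverOverHomogeneous` live in `TemperedResiduallyFiniteStatements.lean`, the Galois property of `𝒢_{∞,F}` in `UniversalCoveringOverGaloisObj.lean`).  This file assembles the pointed Galois domination (`galoisDomination_pointed_of_galoisApprox`)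
from: the developing map (`exists_hom_univCoverOver_of_splitsAt`), temperedness
(`univCoverOver_isTempered_of_isGaloisCountable`), the Galois property
(`isGaloisObj_univCoverOverT`) and residual finiteness (`residuallyFinite_aut_univCoverOver_btemp`)
of `𝒢_{∞,A}`, GIVEN (as hypotheses, supplied by the Galois tower of the rung-1 construction):
(`happrox`) every finite covering is split by a finite covering `A` with one component whose
endomorphisms act transitively on its vertex fibres, and (`htransH`) for such `A` the automorphisms
of `𝒢_{∞,A}` act transitively on its vertex fibres.  Then Prop. 3.6 (iii) follows
(`temperedPiResiduallyFinite_of_galoisApprox`) by the reduction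
`temperedPiResiduallyFinite_of_pointedGaloisDomination`.
-/

namespace Literature.AnabelianGeometry.SemiGraphs

namespace ProfiniteSemiGraph

open CategoryTheory CategoryTheory.Limits
open Literature.AlgebraicGeometry.Frobenioids (IsConnectedObj IsNonemptyObj)

universe u

variable {𝒢 : ProfiniteSemiGraph.{u}}

/-- Splitting is inherited through a splitting covering with nonempty fibres: if `A` splits `F`,
`F` has nonempty fibres and `F` splits `S` at `q`, then `A` splits `S` at `q`.
[cite: MochizukiSemiAnbd2006, Def 3.5(ii) p.37] -/
theorem CovObj.splitsAt_of_splits {A F S : CovObj 𝒢} (hAF : A.Splits F) (hN : F.HasNonemptyFibres)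
    {q : S.Point} (h : F.SplitsAt S q) : A.SplitsAt S q := by
  rcases q with ⟨v, s⟩ | ⟨e, s⟩
  · intro x g hg
    obtain ⟨y⟩ := hN.nonempty_V v
    exact h y g (hAF.1 v x g hg y)
  · intro x g hg
    obtain ⟨y⟩ := hN.nonempty_E e
    exact h y g (hAF.2 e x g hg y)

/-- A finite covering with a point, ONE connected component and fibre-transitive endomorphisms is a
Galois approximation in the above sense: rigidity follows from connectedness
(`CovHom.ext_of_sameComponent`). [cite: MochizukiSemiAnbd2006, Prop 3.6 p.38] -/
theorem galoisApprox_of_connected_levels (𝒢 : ProfiniteSemiGraph.{u})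
    (h : ∀ F : CovObj 𝒢, F.IsFinite → ∃ A : CovObj 𝒢, A.IsFinite ∧ Nonempty A.Point ∧
      (∀ p q : A.Point, A.SameComponent p q) ∧
      (∀ (v : 𝒢.graph.Vertex) (x x' : (A.SV v).obj.V), ∃ σ : A ⟶ A, (σ.fV v).hom.hom x = x') ∧
      A.Splits F) : GaloisApprox 𝒢 := by
  intro F hF
  obtain ⟨A, hAfin, hpt, hconn, htrans, hAF⟩ := h F hF
  exact ⟨A, hAfin, hpt, fun v x₀ σ σ' hσ => CovHom.ext_of_sameComponent σ σ' (Sum.inl ⟨v, x₀⟩)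
    (fun q => hconn _ q) (congrArg (fun z => (Sum.inl ⟨v, z⟩ : A.Point)) hσ), htrans, hAF⟩

/-- The finite-covering form implies the pointed form (Def. 3.5 (ii) supplies the finite `F`
splitting the component; `splitsAt_of_splits`). [cite: MochizukiSemiAnbd2006, Prop 3.6 p.38] -/
theorem galoisApproxPt_of_galoisApprox (𝒢 : ProfiniteSemiGraph.{u}) (h : GaloisApprox 𝒢) :
    GaloisApproxPt 𝒢 := by
  intro T hT p
  obtain ⟨F, hF, hN, hsplitF⟩ := hT p
  obtain ⟨A, hAfin, hpt, hArigid, hAtrans, hAF⟩ := h F hF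
  exact ⟨A, hAfin, hpt, hArigid, hAtrans, fun q hq => CovObj.splitsAt_of_splits hAF hN (hsplitF q hq)⟩

/-- **Pointed Galois domination** ([SemiAnbd] p. 38–39): under the hypotheses of Prop. 3.6, the
pointed Galois approximation property and homogeneity, every object `S` of `B^temp(𝒢)` with a
point `p` receives an arrow from a Galois object `H = 𝒢_{∞,A}` of `B^temp(𝒢)` with residually
finite `Aut H`. [cite: MochizukiSemiAnbd2006, Prop 3.6(iii) pp.38–39] -/
theorem galoisDomination_pointed_of_galoisApproxPt (𝒢 : ProfiniteSemiGraph.{u})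
    (h36 : 𝒢.Prop36Hypotheses) (happrox : GaloisApproxPt 𝒢) (htransH : UnivCoverOverHomogeneous 𝒢)
    (S : BTempCat 𝒢) (p : S.obj.Point) :
    ∃ (H : BTempCat 𝒢) (_ : H ⟶ S), IsGaloisObj H ∧ Group.ResiduallyFinite (Aut H) := by
  have h𝒢 : 𝒢.IsCountable := h36.isCountable
  -- a vertex point of `S` in the component of `p`, and a Galois approximation splitting it
  obtain ⟨v₀, s₀, -⟩ := exists_vertex_point_sameComponent h36.isConnected h36.hasVertex S.obj p
  obtain ⟨A, hAfin, ⟨a⟩, hArigid, hAtrans, hsplitA⟩ := happrox S.obj S.property (Sum.inl ⟨v₀, s₀⟩)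
  obtain ⟨x₀, -⟩ := CovObj.exists_point_over_of_isConnected h36.isConnected A a v₀
  -- the Galois object `H = 𝒢_{∞,A}` based at `[x₀]`
  have hT : (A.univCoverOver (Sum.inl (Quot.mk A.VRel ⟨v₀, x₀⟩)) h𝒢).IsTempered :=
    A.univCoverOver_isTempered_of_isGaloisCountable _ h𝒢 h36.isGaloisCountable hAfin
  obtain ⟨φ, -⟩ := CovObj.exists_hom_univCoverOver_of_splitsAt h𝒢 A S.obj v₀ x₀ s₀ hsplitA
  haveI : Finite ((A.SV v₀).obj.V) := hAfin.finite_V v₀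
  exact ⟨⟨A.univCoverOver (Sum.inl (Quot.mk A.VRel ⟨v₀, x₀⟩)) h𝒢, hT⟩, ObjectProperty.homMk φ,
    isGaloisObj_univCoverOverT h36.isConnected h36.hasVertex A _ h𝒢 hT
      (fun t t' => htransH h𝒢 A _ hAtrans t t'),
    CovObj.residuallyFinite_aut_univCoverOver_btemp A v₀ x₀ h𝒢 (fun x => hAtrans v₀ x₀ x)
      (hArigid v₀ x₀) hT⟩

/-- Pointed Galois domination from the finite-covering form of the approximation property.
[cite: MochizukiSemiAnbd2006, Prop 3.6(iii) pp.38–39] -/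
theorem galoisDomination_pointed_of_galoisApprox (𝒢 : ProfiniteSemiGraph.{u})
    (h36 : 𝒢.Prop36Hypotheses) (happrox : GaloisApprox 𝒢) (htransH : UnivCoverOverHomogeneous 𝒢)
    (S : BTempCat 𝒢) (p : S.obj.Point) :
    ∃ (H : BTempCat 𝒢) (_ : H ⟶ S), IsGaloisObj H ∧ Group.ResiduallyFinite (Aut H) :=
  galoisDomination_pointed_of_galoisApproxPt 𝒢 h36 (galoisApproxPt_of_galoisApprox 𝒢 happrox)
    htransH S p

/-- **[SemiAnbd] Prop. 3.6 (iii)** from the pointed Galois approximation property and homogeneity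
(both outputs of the rung-1 construction of `π₁^temp(𝒢)`): `π₁^temp(𝒢)` is residually finite.
[cite: MochizukiSemiAnbd2006, Prop 3.6(iii) pp.38–39] -/
theorem temperedPiResiduallyFinite_of_galoisApproxPt
    (happrox : ∀ 𝒢 : ProfiniteSemiGraph.{u}, 𝒢.Prop36Hypotheses → GaloisApproxPt 𝒢)
    (htransH : ∀ 𝒢 : ProfiniteSemiGraph.{u}, 𝒢.Prop36Hypotheses → UnivCoverOverHomogeneous 𝒢) :
    TemperedPiResiduallyFinite.{u} :=
  temperedPiResiduallyFinite_of_pointedGaloisDomination fun 𝒢 h36 S p =>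
    galoisDomination_pointed_of_galoisApproxPt 𝒢 h36 (happrox 𝒢 h36) (htransH 𝒢 h36) S p

/-- **[SemiAnbd] Prop. 3.6 (iii)** from the finite-covering form of the Galois approximation
property and homogeneity. [cite: MochizukiSemiAnbd2006, Prop 3.6(iii) pp.38–39] -/
theorem temperedPiResiduallyFinite_of_galoisApprox
    (happrox : ∀ 𝒢 : ProfiniteSemiGraph.{u}, 𝒢.Prop36Hypotheses → GaloisApprox 𝒢)
    (htransH : ∀ 𝒢 : ProfiniteSemiGraph.{u}, 𝒢.Prop36Hypotheses → UnivCoverOverHomogeneous 𝒢) :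
    TemperedPiResiduallyFinite.{u} :=
  temperedPiResiduallyFinite_of_galoisApproxPt
    (fun 𝒢 h36 => galoisApproxPt_of_galoisApprox 𝒢 (happrox 𝒢 h36)) htransH

end ProfiniteSemiGraph

end Literature.AnabelianGeometry.SemiGraphs
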